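import Summits.BirchSwinnertonDyer.BirchSwinnertonDyer.Theorems.AdditiveKolyvaginRoadManinFrameFromDatum
import Literature.NumberTheory.EllipticCurves.ManinConstantModularDegree
import Literature.NumberTheory.EllipticCurves.ModularCurveManinSemistableBridgeProofs
import Literature.NumberTheory.EllipticCurves.CuspFormLFunctionLevelConductorProofs
import HarnessLib

/-!
# Route `AdditiveKolyvaginRoad`, Manin residue `ManinFrameResidueClass` (stmt-BirchSwinnertonDyer-20094):
# prime-to-`p` transport of a Manin datum along the isogeny class, and the DEGREE sub-locus of the
# residue (Česnavičius–Neururer–Saha 2024 Thm. 1.2) — route-independent machinery (`--supports` 20094)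

Cell `pub/bsd-wall` (D-0120, W-ALL lane 3, row 2), seat `bsd-wall-akr-p2` (prover, g3). THEOREMS
ONLY (no definition, no named fact, no `sorry`); nothing is booked. NO route file is imported
(theses-cone hygiene, as in `AdditiveKolyvaginRoadManinFrameFromDatum.lean`): the thin item-level
reading that consumes this file imports the route file itself.

WHAT THE RESIDUE IS. Item 20094 asks for the 9-conjunct Manin-good odd Heegner frame of
`ManinGoodOddFrameAdditive` on the residue class (`p ∈ {5, 7}`, or Edixhoven's exception
"potentially good ordinary of Kodaira type II/III/IV" somewhere in the class; and no `Iₙ*` member).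
By `ManinFrameFromDatum.exists_oddHeegnerFrame_of_exists_not_dvd` the frame follows from ANY
parametrisation datum `Dt` of `W` at level `N(W)` with `p ∤ c(Dt)`; and the admissible constants of
`W` are the multiples of `c₀ · k₀` (`c₀` the optimal constant of the class, `k₀` the Néron scaling
of the cyclic isogeny `W₀ → W`, prime to `p` under `Irr`), so on the residue the item IS the
`p`-part of Manin's conjecture for the optimal curve — open in print (Edixhoven 1991 Thm. 3 needs
`p > 7` and excludes exactly these types; Česnavičius–Neururer–Saha 2024 §1 records the exception
as the state of the art). What print DOES give on the residue, with no optimality and no Kodaira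
restriction, is Česnavičius–Neururer–Saha 2024 Thm. 1.2: `val_p(c_φ) ≤ val_p(deg φ)` at every
`p ≥ 5` for EVERY surjection `φ : X₀(N)_ℚ ↠ E'` onto ANY member `E'` (tree named fact
`cesnaviciusNeururerSaha_padicVal_maninConstant_le_modularDegree`, corollary
`not_dvd_maninConstant_of_not_dvd_modularDegree`). This file turns that into the frame on the
**degree sub-locus of the residue**: some globally minimal member `W' ∼ W` carries a parametrisation
datum whose modular degree is prime to `p`.

CONTENT.
* §1 `exists_modularParametrizationData_not_dvd_of_partner` — **prime-to-`p` transport of a Manin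
  datum along the class**: `W, W'/ℚ` globally minimal and `ℚ`-isogenous, `E[p]` irreducible
  (`Irr W p`), `D'` ANY datum of `W'` (any level `N'`) with `p ∤ c(D')` ⟹ a datum of `W` at level
  `N'` with `p ∤ c`. Proof: the newform of `W'` is a newform of `W` (`IsNewformOf.of_isIsogenous`,
  Faltings: same `L`-series); an integral multiplier `k Λ_{W'} ⊆ Λ_W` with `p ∤ k`
  (`X11b.exists_int_mul_mem_lattice_not_dvd`: a cyclic `ℚ`-isogeny `W → W'` has degree prime to `p`
  under `Irr`; the Néron mapping property is the tree THEOREM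
  `integral_neronScaling_of_isGloballyMinimal_holds`); the datum `(f, Λ_W, k·c')`
  (`ModularParametrizationData.exists_of_isNewformOf`). The optimal-partner instances of this
  transport are inlined in items 20092/20093 (`…_of_strongException`, `…_of_istarClass`); here the
  partner is arbitrary, which is what the degree reading needs (the member with `p ∤ deg` need not
  be the strong curve).
* §2 `exists_modularParametrizationData_not_dvd_of_not_dvd_modularDegree` — **the degree sub-locus**:
  modulo the ČNS fact `hCNS` and modularity `hnf` (level bookkeeping only:
  `IsNewformOf.level_eq_conductorNorm_of_exists_isNewformOf`), for `p ≥ 5`, `Irr W p`, and a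
  globally minimal `W' ∼ W` with a datum `D'` at level `N(W)` (`= N(W')`) with `p ∤ deg(D')`:
  a datum of `W` at level `N(W)` with `p ∤ c`. And the member-free special case
  `exists_modularParametrizationData_not_dvd_of_not_dvd_modularDegree_self` (`W' = W`: no `Irr`).
* §3 `exists_oddHeegnerFrame_of_not_dvd_modularDegree` (and `…_self`) — **the 9-conjunct frame on
  the degree sub-locus** at an odd `p ≥ 5` with `r_an = 1`, by §2 and
  `ManinFrameFromDatum.exists_oddHeegnerFrame_of_exists_not_dvd` (Hoffstein–Luo field, Darmon's
  Thm. 3.6 point, minimal model of the twist). No `Addv`, no Kodaira hypothesis: the degree reading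
  is uniform in the reduction type, so it serves the residue 20094 (where nothing else in print
  applies) as well as the closed loci.

References: [CesnaviciusNeururerSaha2023] K. Česnavičius, M. Neururer, A. Saha, *The Manin constant
and the modular degree*, JEMS 26 (2024) 573–637, Thm. 1.2 and §1 (held `paper:arxiv-1911.09446`
p. 3: the Edixhoven exception and "`val_p(c_φ) ≤ val_p(deg(φ))` … eliminates some additive
reduction primes"); [EdixhovenManin1991] Thm. 3; [JetchevSkinnerWan2017] §7.4.1, Remark 43;
[AgasheRibetStein2006] Thm. 2.6, §2; [HoffsteinLuo1997] Theorem (§1); [Darmon2004] Thm. 3.6;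
[SilvermanATAEC1994] IV.5.1, IV.6.1 (Néron mapping property).
-/

set_option autoImplicit false
-- the Theorems directory repeats the summit name (sibling precedent `SignedBaseChangeAssembly.lean`)
set_option linter.dupNamespace false

noncomputable section

open scoped Classical

open WeierstrassCurve NumberField Literature.NumberTheory.EllipticCurves
  Literature.NumberTheory.EllipticCurves.ModularForms
  Literature.NumberTheory.EllipticCurves.Rank1Residual Literature.NumberTheory.Automorphic
  Summit.BirchSwinnertonDyer.Rank1Residual

namespace Summit.BirchSwinnertonDyer.BirchSwinnertonDyer.Theorems.ManinFrameTransport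

/-! ### §1 Prime-to-`p` transport of a Manin datum along the isogeny class -/

/-- **Prime-to-`p` transport of a Manin datum along the class.** For globally minimal `W ∼ W'`
over `ℚ` with `E[p]` irreducible (`Irr W p`) and ANY parametrisation datum `D'` of `W'` (any level
`N'`) with `p ∤ c(D')`, there is a datum of `W` at level `N'` with `p ∤ c`: the newform of `W'` is a
newform of `W` (`IsNewformOf.of_isIsogenous`), a cyclic `ℚ`-isogeny `W → W'` has degree prime to
`p`, whence an integral multiplier `k Λ_{W'} ⊆ Λ_W` with `p ∤ k`
(`X11b.exists_int_mul_mem_lattice_not_dvd`, Néron mapping property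
`integral_neronScaling_of_isGloballyMinimal_holds`), and `(f, Λ_W, k·c')` is a datum
(`ModularParametrizationData.exists_of_isNewformOf`).
[cite: JetchevSkinnerWan2017, §7.4.1 (p. 30) and Remark 43] [cite: AgasheRibetStein2006, Thm. 2.6 and §2]
[cite: SilvermanATAEC1994, IV.5.1 with IV.6.1] -/
theorem exists_modularParametrizationData_not_dvd_of_partner
    (W : WeierstrassCurve ℚ) [W.IsElliptic] [W.IsGloballyMinimal] {p : ℕ} (hp : p.Prime)
    (hirr : W.HasIrreducibleModPGaloisRep p)
    {W' : WeierstrassCurve ℚ} [W'.IsElliptic] [W'.IsGloballyMinimal] (hiso : IsIsogenous W W')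
    {N' : ℕ} [NeZero N'] (D' : ModularParametrizationData W' N') (hc' : ¬ (p : ℤ) ∣ D'.c) :
    ∃ Dt : ModularParametrizationData W N', ¬ (p : ℤ) ∣ Dt.c := by
  haveI : (W.baseChange ℂ).IsElliptic := by rw [WeierstrassCurve.baseChange]; infer_instance
  -- the newform of `W'` is a newform of `W`
  have hfW : IsNewformOf W D'.f := D'.isNewformOf.of_isIsogenous hiso
  -- an integral multiplier `k : Λ_{W'} → Λ_W` prime to `p` (Néron mapping property, a theorem)
  obtain ⟨LW, hLW⟩ := exists_isNeronLatticeOf_holds (W.baseChange ℂ)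
  obtain ⟨k, hk0, hpk, hk⟩ :=
    X11b.exists_int_mul_mem_lattice_not_dvd integral_neronScaling_of_isGloballyMinimal_holds
      hiso.symm_of_charZero D'.isNeronLattice hLW hp hirr
  -- the datum `(f, Λ_W, k c')` of `W`
  have hm0 : k * D'.c ≠ 0 := mul_ne_zero hk0 D'.maninConstant_ne_zero_holds
  have hle : ∀ z ∈ periodLattice D'.f, ((k * D'.c : ℤ) : ℂ) * z ∈ LW.lattice := fun z hz ↦ by
    have h2 := hk _ (D'.smul_periodLattice_le z hz)
    rwa [← mul_assoc, ← Int.cast_mul] at h2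
  obtain ⟨D, -, -, hDc⟩ := ModularParametrizationData.exists_of_isNewformOf hfW hLW hm0 hle
  refine ⟨D, fun hdvd ↦ ?_⟩
  rw [hDc] at hdvd
  rcases (Nat.prime_iff_prime_int.mp hp).dvd_or_dvd hdvd with h | h
  · exact hpk h
  · exact hc' h

/-! ### §2 The degree sub-locus: `p ∤ deg(D')` for a datum of some member (ČNS 2024 Thm. 1.2) -/

/-- **`p ∤ c(D)` from `p ∤ deg(D)` at `p ≥ 5`, with the level a free index `N = N(W)`**
(`not_dvd_maninConstant_of_not_dvd_modularDegree` re-keyed): under the ČNS fact, for a datum `D`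
of a globally minimal `W` at a level `N` equal to the conductor, `p ≥ 5` and `p ∤ deg(D)` give
`p ∤ c(D)`. [cite: CesnaviciusNeururerSaha2023, Thm. 1.2] -/
theorem not_dvd_c_of_not_dvd_modularDegree
    (hCNS : cesnaviciusNeururerSaha_padicVal_maninConstant_le_modularDegree)
    (W : WeierstrassCurve ℚ) [W.IsElliptic] [W.IsGloballyMinimal] {N : ℕ} [NeZero N]
    (hN : W.conductorNorm ℤ = N) (D : ModularParametrizationData W N) {p : ℕ} (hp : p.Prime)
    (hp5 : 5 ≤ p) (hdeg : ¬ p ∣ D.modularDegree) : ¬ (p : ℤ) ∣ D.c := by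
  subst hN
  exact not_dvd_maninConstant_of_not_dvd_modularDegree hCNS W D hp hp5 hdeg

/-- **A datum of `W` with `p ∤ c` on the DEGREE sub-locus of the class**: modulo the ČNS fact `hCNS`
and modularity `hnf` (only for `N(W') = N(W)`, `IsNewformOf.level_eq_conductorNorm_of_exists_isNewformOf`),
for `W/ℚ` globally minimal, `p ≥ 5` with `E[p]` irreducible, and a globally minimal `W' ∼ W` with a
parametrisation datum `D'` at level `N(W)` whose modular degree is prime to `p`: a datum of `W` at
level `N(W)` with `p ∤ c`. No optimality, no reduction-type hypothesis (ČNS Thm. 1.2 is about every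
surjection `X₀(N)_ℚ ↠ E'`); transport by `exists_modularParametrizationData_not_dvd_of_partner`.
[cite: CesnaviciusNeururerSaha2023, Thm. 1.2] [cite: JetchevSkinnerWan2017, §7.4.1 and Remark 43] -/
theorem exists_modularParametrizationData_not_dvd_of_not_dvd_modularDegree
    (hnf : exists_isNewformOf)
    (hCNS : cesnaviciusNeururerSaha_padicVal_maninConstant_le_modularDegree)
    (W : WeierstrassCurve ℚ) [W.IsElliptic] [W.IsGloballyMinimal] [NeZero (W.conductorNorm ℤ)]
    {p : ℕ} (hp : p.Prime) (hp5 : 5 ≤ p) (hirr : W.HasIrreducibleModPGaloisRep p)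
    {W' : WeierstrassCurve ℚ} [W'.IsElliptic] [W'.IsGloballyMinimal] (hiso : IsIsogenous W W')
    (D' : ModularParametrizationData W' (W.conductorNorm ℤ)) (hdeg : ¬ p ∣ D'.modularDegree) :
    ∃ Dt : ModularParametrizationData W (W.conductorNorm ℤ), ¬ (p : ℤ) ∣ Dt.c := by
  -- the level `N(W)` is the conductor of `W'` (the newform of `W'` lives at level `N(W')`)
  have hN' : W'.conductorNorm ℤ = W.conductorNorm ℤ :=
    (IsNewformOf.level_eq_conductorNorm_of_exists_isNewformOf hnf D'.isNewformOf).symm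
  exact exists_modularParametrizationData_not_dvd_of_partner W hp hirr hiso D'
    (not_dvd_c_of_not_dvd_modularDegree hCNS W' hN' D' hp hp5 hdeg)

/-- **The member-free special case (`W' = W`)**: under the ČNS fact, a datum `D` of the globally
minimal `W` itself at level `N(W)` with `p ∤ deg(D)`, `p ≥ 5`, already has `p ∤ c(D)` — no `Irr`,
no transport. [cite: CesnaviciusNeururerSaha2023, Thm. 1.2] -/
theorem exists_modularParametrizationData_not_dvd_of_not_dvd_modularDegree_self
    (hCNS : cesnaviciusNeururerSaha_padicVal_maninConstant_le_modularDegree)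
    (W : WeierstrassCurve ℚ) [W.IsElliptic] [W.IsGloballyMinimal] [NeZero (W.conductorNorm ℤ)]
    {p : ℕ} (hp : p.Prime) (hp5 : 5 ≤ p)
    (D : ModularParametrizationData W (W.conductorNorm ℤ)) (hdeg : ¬ p ∣ D.modularDegree) :
    ∃ Dt : ModularParametrizationData W (W.conductorNorm ℤ), ¬ (p : ℤ) ∣ Dt.c :=
  ⟨D, not_dvd_maninConstant_of_not_dvd_modularDegree hCNS W D hp hp5 hdeg⟩

/-! ### §3 The odd Heegner frame on the degree sub-locus -/

/-- **The 9-conjunct Manin-good odd Heegner frame on the DEGREE sub-locus of the class** — the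
conclusion of `ManinGoodOddFrameAdditive` / `ManinFrameResidueClass`: modulo Modularity `hnf`,
Hoffstein–Luo `hHL` and the ČNS fact `hCNS`, for `W/ℚ` globally minimal with `r_an = 1`, a prime
`p ≥ 5` with `E[p]` irreducible, and a globally minimal `W' ∼ W` carrying a parametrisation datum
at level `N(W)` of modular degree prime to `p`: the Hoffstein–Luo field `K`, a datum `Dt` of `W`
with `p ∤ c(Dt)`, its Heegner point in `E(K)`, and a minimal model of the twist
(`ManinFrameFromDatum.exists_oddHeegnerFrame_of_exists_not_dvd` fed with §2). Uniform in the
reduction type of `W` at `p` (no `Addv`, no Kodaira hypothesis), so it applies on the Manin residue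
of the route. [cite: CesnaviciusNeururerSaha2023, Thm. 1.2]
[cite: HoffsteinLuo1997, Theorem (§1, pp. 435–436)] [cite: Darmon2004, Thm. 3.6] -/
theorem exists_oddHeegnerFrame_of_not_dvd_modularDegree (hnf : exists_isNewformOf)
    (hHL : HoffsteinLuo1997_exists_twist_L_one_ne_zero)
    (hCNS : cesnaviciusNeururerSaha_padicVal_maninConstant_le_modularDegree)
    (W : WeierstrassCurve ℚ) [W.IsElliptic] [W.IsGloballyMinimal] (p : ℕ) [hp : Fact p.Prime]
    [NeZero (W.conductorNorm ℤ)] (hr : W.analyticRank = 1) (hp5 : 5 ≤ p)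
    (hirr : W.HasIrreducibleModPGaloisRep p)
    {W' : WeierstrassCurve ℚ} [W'.IsElliptic] [W'.IsGloballyMinimal] (hiso : IsIsogenous W W')
    (D' : ModularParametrizationData W' (W.conductorNorm ℤ)) (hdeg : ¬ p ∣ D'.modularDegree) :
    ∃ (K : Type) (_ : Field K) (_ : NumberField K)
      (Dt : ModularParametrizationData W (W.conductorNorm ℤ))
      (H : HeegnerDatum (W.conductorNorm ℤ) (NumberField.discr K)) (ι : K →+* ℂ)
      (P : (W.baseChange K).toAffine.Point)
      (Wd : WeierstrassCurve ℚ) (_ : Wd.IsElliptic) (_ : Wd.IsGloballyMinimal) (Cd : VariableChange ℚ),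
      IsImaginaryQuadratic K ∧ Odd (NumberField.discr K) ∧ ¬ (p : ℤ) ∣ NumberField.discr K ∧
        SatisfiesHeegnerHypothesis (W.conductorNorm ℤ) K ∧
        WeierstrassCurve.Affine.Point.map ι.toRatAlgHom P = heegnerPointComplex Dt H ∧
        ¬ (p : ℤ) ∣ Dt.c ∧ ¬ p ∣ Units.torsionOrder K ∧
        (W.quadraticTwist (NumberField.discr K : ℚ)).entireLFunction 1 ≠ 0 ∧
        Cd • W.quadraticTwist (NumberField.discr K : ℚ) = Wd :=
  ManinFrameFromDatum.exists_oddHeegnerFrame_of_exists_not_dvd hnf hHL W p hr (by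
      rintro rfl; omega)
    (exists_modularParametrizationData_not_dvd_of_not_dvd_modularDegree hnf hCNS W hp.out hp5 hirr
      hiso D' hdeg)

/-- **The frame from a datum of `W` itself with `p ∤ deg`** (`W' = W`; no `Irr`): modulo `hnf`,
`hHL`, `hCNS`, for `W/ℚ` globally minimal with `r_an = 1`, `p ≥ 5`, and a datum `D` of `W` at
level `N(W)` with `p ∤ deg(D)`, the 9-conjunct frame. [cite: CesnaviciusNeururerSaha2023, Thm. 1.2]
[cite: HoffsteinLuo1997, Theorem (§1)] [cite: Darmon2004, Thm. 3.6] -/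
theorem exists_oddHeegnerFrame_of_not_dvd_modularDegree_self (hnf : exists_isNewformOf)
    (hHL : HoffsteinLuo1997_exists_twist_L_one_ne_zero)
    (hCNS : cesnaviciusNeururerSaha_padicVal_maninConstant_le_modularDegree)
    (W : WeierstrassCurve ℚ) [W.IsElliptic] [W.IsGloballyMinimal] (p : ℕ) [hp : Fact p.Prime]
    [NeZero (W.conductorNorm ℤ)] (hr : W.analyticRank = 1) (hp5 : 5 ≤ p)
    (D : ModularParametrizationData W (W.conductorNorm ℤ)) (hdeg : ¬ p ∣ D.modularDegree) :
    ∃ (K : Type) (_ : Field K) (_ : NumberField K)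
      (Dt : ModularParametrizationData W (W.conductorNorm ℤ))
      (H : HeegnerDatum (W.conductorNorm ℤ) (NumberField.discr K)) (ι : K →+* ℂ)
      (P : (W.baseChange K).toAffine.Point)
      (Wd : WeierstrassCurve ℚ) (_ : Wd.IsElliptic) (_ : Wd.IsGloballyMinimal) (Cd : VariableChange ℚ),
      IsImaginaryQuadratic K ∧ Odd (NumberField.discr K) ∧ ¬ (p : ℤ) ∣ NumberField.discr K ∧
        SatisfiesHeegnerHypothesis (W.conductorNorm ℤ) K ∧
        WeierstrassCurve.Affine.Point.map ι.toRatAlgHom P = heegnerPointComplex Dt H ∧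
        ¬ (p : ℤ) ∣ Dt.c ∧ ¬ p ∣ Units.torsionOrder K ∧
        (W.quadraticTwist (NumberField.discr K : ℚ)).entireLFunction 1 ≠ 0 ∧
        Cd • W.quadraticTwist (NumberField.discr K : ℚ) = Wd :=
  ManinFrameFromDatum.exists_oddHeegnerFrame_of_exists_not_dvd hnf hHL W p hr (by
      rintro rfl; omega)
    (exists_modularParametrizationData_not_dvd_of_not_dvd_modularDegree_self hCNS W hp.out hp5 D hdeg)

/-! ### §4 Conversely: a datum of `W` with `p ∤ c` forces `p ∤ c₀` at the lattice-optimal curve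

The transport of §1 runs both ways under `Irr`, so `∃ Dt, p ∤ c(Dt)` for ONE member is equivalent
to `p ∤ c₀` for the lattice-optimal datum of the `X₀(N)`-optimal curve of the class: the Manin
residue 20094 is EXACTLY the `p`-part of Manin's conjecture there (not merely implied by it). -/

/-- **A member with a datum prime to `p` forces `p ∤ c₀` at the lattice-optimal curve.** For
globally minimal `W ∼ W₀` over `ℚ` with `E[p]` irreducible, a datum `Dt` of `W` (level `N`) with
`p ∤ c(Dt)`, and a LATTICE-OPTIMAL datum `D₀` of `W₀` at the same level (`Λ_{W₀} = c₀ Λ_f`; the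
strong parametrisation, Edixhoven 1991 Prop. 2): `p ∤ c₀`. Proof: `D₀.f = Dt.f` (both are THE
newform of the class: `IsNewformOf.of_isIsogenous` and the `q`-expansion principle
`eq_of_forall_cuspCoeff_eq_gamma0`); `E₀[p]` is irreducible too
(`not_hasIrreducibleModPGaloisRep_of_isIsogenous`); an integral multiplier `k Λ_W ⊆ Λ_{W₀}` with
`p ∤ k` (`X11b.exists_int_mul_mem_lattice_not_dvd`); then `(k·c/c₀) Λ_{W₀} = k·c Λ_f ⊆ k Λ_W ⊆ Λ_{W₀}`,
so `k·c/c₀ ∈ ℤ` (`integral_neronScaling_of_isGloballyMinimal_holds`), i.e. `c₀ ∣ k·c`, and `p ∣ c₀`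
would give `p ∣ k` or `p ∣ c`. [cite: EdixhovenManin1991, §1 and Prop. 2]
[cite: AgasheRibetStein2006, Thm. 2.6 and §2] [cite: SilvermanATAEC1994, IV.5.1 with IV.6.1] -/
theorem not_dvd_optimal_c_of_exists_not_dvd
    (W : WeierstrassCurve ℚ) [W.IsElliptic] [W.IsGloballyMinimal] {p : ℕ} (hp : p.Prime)
    (hirr : W.HasIrreducibleModPGaloisRep p) {N : ℕ} [NeZero N]
    (hD : ∃ Dt : ModularParametrizationData W N, ¬ (p : ℤ) ∣ Dt.c)
    {W₀ : WeierstrassCurve ℚ} [W₀.IsElliptic] [W₀.IsGloballyMinimal] (hiso : IsIsogenous W W₀)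
    (D₀ : ModularParametrizationData W₀ N)
    (hopt : ∀ z ∈ D₀.L.lattice, ∃ w ∈ periodLattice D₀.f, z = D₀.c * w) :
    ¬ (p : ℤ) ∣ D₀.c := by
  haveI : Fact p.Prime := ⟨hp⟩
  obtain ⟨Dt, hc⟩ := hD
  -- both data carry THE newform of the class
  have hfW₀ : IsNewformOf W₀ Dt.f := Dt.isNewformOf.of_isIsogenous hiso.symm_of_charZero
  have hf : D₀.f = Dt.f :=
    eq_of_forall_cuspCoeff_eq_gamma0 fun n ↦ by rw [D₀.isNewformOf.2 n, hfW₀.2 n]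
  -- `E₀[p]` is irreducible
  have hirr₀ : W₀.HasIrreducibleModPGaloisRep p := by
    by_contra h
    exact not_hasIrreducibleModPGaloisRep_of_isIsogenous hiso.symm_of_charZero h hirr
  -- an integral multiplier `k : Λ_W → Λ_{W₀}` prime to `p`
  obtain ⟨k, -, hpk, hk⟩ :=
    X11b.exists_int_mul_mem_lattice_not_dvd integral_neronScaling_of_isGloballyMinimal_holds
      hiso Dt.isNeronLattice D₀.isNeronLattice hp hirr₀
  have hc₀ : D₀.c ≠ 0 := D₀.maninConstant_ne_zero_holds
  have hc₀ℂ : (D₀.c : ℂ) ≠ 0 := by exact_mod_cast hc₀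
  -- `(k c / c₀) Λ_{W₀} ⊆ Λ_{W₀}`
  have key : ∀ z ∈ D₀.L.lattice, ((((k * Dt.c : ℤ) : ℚ) / D₀.c : ℚ) : ℂ) * z ∈ D₀.L.lattice := by
    intro z hz
    obtain ⟨w, hw, rfl⟩ := hopt z hz
    rw [hf] at hw
    have h2 : (k : ℂ) * ((Dt.c : ℂ) * w) ∈ D₀.L.lattice := hk _ (Dt.smul_periodLattice_le w hw)
    convert h2 using 1
    push_cast
    field_simp
  obtain ⟨m, hm⟩ := integral_neronScaling_of_isGloballyMinimal_holds W₀ W₀ D₀.L D₀.L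
    D₀.isNeronLattice D₀.isNeronLattice _ key
  -- `c₀ ∣ k c`
  have hc₀ℚ : (D₀.c : ℚ) ≠ 0 := by exact_mod_cast hc₀
  have hprod : k * Dt.c = D₀.c * m := by
    have h : ((k * Dt.c : ℤ) : ℚ) = ((D₀.c * m : ℤ) : ℚ) := by
      push_cast at hm ⊢
      rw [hm]
      field_simp
    exact_mod_cast h
  intro hdvd
  have hkc : (p : ℤ) ∣ k * Dt.c := hprod ▸ dvd_mul_of_dvd_left hdvd m
  rcases (Nat.prime_iff_prime_int.mp hp).dvd_or_dvd hkc with h | h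
  · exact hpk h
  · exact hc h

end Summit.BirchSwinnertonDyer.BirchSwinnertonDyer.Theorems.ManinFrameTransport

end
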